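import Summits.AnomalousDissipation.AnomalousDissipation.Theorems.SolenoidalFractalHomogenisationLagrangianStepLedgerSplitSlopWindow
import HarnessLib

/-!
# K1L_D (stmt-AnomalousDissipation-27980), S23‴ `stub_windowDefectH`: the label-split window ledger WITH ADDITIVE SLOP —
# part 2: `window_ledger_split_slop` (helper; `--supports … --as helper`; lead-k1l-onelevel-p1 g3)

`window_ledger_split` (p661019) with super-small ADDITIVE slop in its two exact hypotheses (why: p4 g12 L4c §3.1/§4.1 — under the frame
distortion no label class is exactly invariant; and the cell side weights (DD) by the dissipation of the LOW-LABEL part of the state, which is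
`𝔇_k(u k)` up to a super-small additive term):
* (DD) with slop: `|⟪y, e k⟫| ≤ η √𝔇_k √𝔇*_k(y) + a k · ‖y‖` (`a k ≥ 0`),
* budget with slop: `Σ_{k<K} (F k + 2 c k) ≤ η′ Σ_{k<K} 𝔇_k + B` (`B ≥ 0`).
CONCLUSION (uniform in `K`): `‖u K‖² ≤ ‖v K‖² + 4(η + η′)(‖v 0‖² − ‖v K‖²) + 10 (Σ s k) ‖v 0‖ + 8 (Σ a k) ‖v 0‖ + 4 Σ (a k)² + 2 B`.
The additive terms are absorbed downstream by the coarse drop floor (`stub_baseT` scale) because they are super-polynomially small in `ρ`.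
One-window balances and the sums: `…LedgerSplitSlopWindow`.  Pure Hilbert-space algebra.  Infrastructure for rung F-D1.A0; NOT a proof of
the crux or of anomalous dissipation.
-/

set_option linter.dupNamespace false

namespace Summit.AnomalousDissipation.AnomalousDissipation.Theorems.SolenoidalFractalHomogenisation.LagrangianStep

open scoped InnerProductSpace
open ContinuousLinearMap

noncomputable section

variable {V : Type*} [NormedAddCommGroup V] [InnerProductSpace ℝ V] [CompleteSpace V]

/-- The closing arithmetic of the ledger with slop (pure real inequalities): from the collected duality/discrepancy bound and the energy
sum, with `η, η′ ≤ 1/8`, to the final shape.  `P₁ = ‖v 0‖·Σ s`, `P₂ = ‖v 0‖·Σ a`, `A₂ = Σ a²`. -/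
theorem ledger_arith_slop {uK vK E0 S P₁ P₂ A₂ B η η' : ℝ} (hη : 0 ≤ η) (hη8 : η ≤ 1 / 8) (hη' : 0 ≤ η') (hη'8 : η' ≤ 1 / 8)
    (hS : 0 ≤ S) (hP₁ : 0 ≤ P₁) (hP₂ : 0 ≤ P₂) (hA₂ : 0 ≤ A₂) (hB : 0 ≤ B) (hvK : vK ≤ E0)
    (hcollect : uK ≤ vK + η * (E0 - vK) + (η + 3 * η ^ 2 + η') * S + 8 * P₁ + 6 * P₂ + 2 * A₂ + B)
    (henergy : (1 - 2 * η - 2 * η ^ 2) * S ≤ E0 - uK + 2 * P₂ + 2 * A₂ + 2 * P₁ + η' * S + B) :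
    uK ≤ vK + 4 * (η + η') * (E0 - vK) + 10 * P₁ + 8 * P₂ + 4 * A₂ + 2 * B := by
  have hdropv : 0 ≤ E0 - vK := by linarith
  have hpos1 : 0 ≤ 4 * (η + η') * (E0 - vK) := by positivity
  have hηη : η * η ≤ η * (1 / 8) := mul_le_mul_of_nonneg_left hη8 hη
  have hsqη : η ^ 2 = η * η := sq η
  have hcoefS : (η + 3 * η ^ 2 + η') * S ≤ (11 / 8 * η + η') * S := by
    refine mul_le_mul_of_nonneg_right ?_ hS
    rw [hsqη]; linarith
  by_cases hcase : uK ≤ vK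
  · linarith
  · have hdropu : E0 - uK ≤ E0 - vK := by linarith
    have hκ : (23 : ℝ) / 32 ≤ 1 - 2 * η - 2 * η ^ 2 := by
      have : η * η ≤ 1 / 8 * (1 / 8) := mul_le_mul hη8 hη8 hη (by norm_num)
      rw [hsqη]; linarith
    have hκS : (23 : ℝ) / 32 * S ≤ (1 - 2 * η - 2 * η ^ 2) * S := mul_le_mul_of_nonneg_right hκ hS
    have hη'S : η' * S ≤ 1 / 8 * S := mul_le_mul_of_nonneg_right hη'8 hS
    have hJ : 0 ≤ 2 * P₂ + 2 * A₂ + 2 * P₁ + B := by positivity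
    have hS' : (19 : ℝ) / 32 * S ≤ (E0 - vK) + (2 * P₂ + 2 * A₂ + 2 * P₁ + B) := by linarith
    have hSb : S ≤ 32 / 19 * ((E0 - vK) + (2 * P₂ + 2 * A₂ + 2 * P₁ + B)) := by linarith
    have hc0 : 0 ≤ 11 / 8 * η + η' := by positivity
    have hmain : (11 / 8 * η + η') * S ≤ (11 / 8 * η + η') * (32 / 19 * ((E0 - vK) + (2 * P₂ + 2 * A₂ + 2 * P₁ + B))) :=
      mul_le_mul_of_nonneg_left hSb hc0
    have hcoef1 : (11 / 8 * η + η') * (32 / 19) ≤ 3 * (η + η') := by linarith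
    have hcoef2 : (11 / 8 * η + η') * (32 / 19) ≤ 3 / 4 := by linarith
    have hA' : (11 / 8 * η + η') * (32 / 19 * (E0 - vK)) ≤ 3 * (η + η') * (E0 - vK) := by
      have h2 := mul_le_mul_of_nonneg_right hcoef1 hdropv
      linarith
    have hB' : (11 / 8 * η + η') * (32 / 19 * (2 * P₂ + 2 * A₂ + 2 * P₁ + B)) ≤ 3 / 4 * (2 * P₂ + 2 * A₂ + 2 * P₁ + B) := by
      have h3 := mul_le_mul_of_nonneg_right hcoef2 hJ
      linarith
    have hsum : (11 / 8 * η + η') * S ≤ 3 * (η + η') * (E0 - vK) + 3 / 4 * (2 * P₂ + 2 * A₂ + 2 * P₁ + B) := by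
      have : (11 / 8 * η + η') * (32 / 19 * ((E0 - vK) + (2 * P₂ + 2 * A₂ + 2 * P₁ + B)))
          = (11 / 8 * η + η') * (32 / 19 * (E0 - vK)) + (11 / 8 * η + η') * (32 / 19 * (2 * P₂ + 2 * A₂ + 2 * P₁ + B)) := by
        ring
      linarith
    have hηdrop : η * (E0 - vK) ≤ (η + η') * (E0 - vK) := mul_le_mul_of_nonneg_right (by linarith) hdropv
    linarith [hcollect, hcoefS, hsum, hηdrop]

/-- **THE LABEL-SPLIT WINDOW LEDGER WITH SLOP.**  `T k` linear contractions of a real Hilbert space; `v (k+1) = T k (v k)` the exact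
(coarse) chain; `u (k+1) = T k (u k) + e k + f k` the true chain from the same start, norm-bounded by its start; `e k` dissipation-dominated
against every test vector UP TO SLOP `a k ‖y‖` (`0 ≤ η ≤ 1/8`, `a k ≥ 0`); `f k` with energy `‖f k‖² ≤ F k`, coarse-invisible
(`‖T (k+1) (f k)‖ ≤ s k`, `‖(T k)† (f k)‖ ≤ s k`), overlap `|⟪e k, f k⟫| ≤ c k`, and budget WITH SLOP
`Σ_{k<K}(F k + 2 c k) ≤ η′·Σ_{k<K} 𝔇_k(u k) + B` AT THE GIVEN `K` (`0 ≤ η′ ≤ 1/8`, `B ≥ 0`; only this `K` is used).  Then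
`‖u K‖² ≤ ‖v K‖² + 4(η + η′)·(‖v 0‖² − ‖v K‖²) + 10·(Σ_{k<K} s k)·‖v 0‖ + 8·(Σ_{k<K} a k)·‖v 0‖ + 4·Σ_{k<K} (a k)² + 2B`. -/
theorem window_ledger_split_slop (T : ℕ → V →L[ℝ] V) (hT : ∀ k x, ‖T k x‖ ≤ ‖x‖) (u v e f : ℕ → V) (η η' B : ℝ)
    (F c s a : ℕ → ℝ)
    (hη : 0 ≤ η) (hη8 : η ≤ 1 / 8) (hη' : 0 ≤ η') (hη'8 : η' ≤ 1 / 8) (hB : 0 ≤ B) (hs : ∀ k, 0 ≤ s k) (ha : ∀ k, 0 ≤ a k)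
    (h0 : u 0 = v 0) (hv : ∀ k, v (k + 1) = T k (v k)) (hu : ∀ k, u (k + 1) = T k (u k) + e k + f k)
    (huB : ∀ k, ‖u k‖ ≤ ‖u 0‖)
    (hDD : ∀ k, ∀ y : V, |⟪y, e k⟫_ℝ| ≤
      η * Real.sqrt (‖u k‖ ^ 2 - ‖T k (u k)‖ ^ 2) * Real.sqrt (‖y‖ ^ 2 - ‖adjoint (T k) y‖ ^ 2) + a k * ‖y‖)
    (hF1 : ∀ k, ‖f k‖ ^ 2 ≤ F k) (hF2 : ∀ k, ‖T (k + 1) (f k)‖ ≤ s k) (hF3 : ∀ k, ‖adjoint (T k) (f k)‖ ≤ s k)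
    (hF4 : ∀ k, |⟪e k, f k⟫_ℝ| ≤ c k)
    (K : ℕ)
    (hbudget : ∑ k ∈ Finset.range K, (F k + 2 * c k) ≤ η' * ∑ k ∈ Finset.range K, (‖u k‖ ^ 2 - ‖T k (u k)‖ ^ 2) + B) :
    ‖u K‖ ^ 2 ≤ ‖v K‖ ^ 2 + 4 * (η + η') * (‖v 0‖ ^ 2 - ‖v K‖ ^ 2) + 10 * (∑ k ∈ Finset.range K, s k) * ‖v 0‖
      + 8 * (∑ k ∈ Finset.range K, a k) * ‖v 0‖ + 4 * (∑ k ∈ Finset.range K, a k ^ 2) + 2 * B := by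
  have hS : 0 ≤ ∑ k ∈ Finset.range K, (‖u k‖ ^ 2 - ‖T k (u k)‖ ^ 2) := Finset.sum_nonneg fun k _ => dissip_nonneg (hT k) (u k)
  have hSs : 0 ≤ ∑ k ∈ Finset.range K, s k := Finset.sum_nonneg fun k _ => hs k
  have hA : 0 ≤ ∑ k ∈ Finset.range K, a k := Finset.sum_nonneg fun k _ => ha k
  have hA₂ : 0 ≤ ∑ k ∈ Finset.range K, a k ^ 2 := Finset.sum_nonneg fun k _ => sq_nonneg (a k)
  have hv0 : 0 ≤ ‖v 0‖ := norm_nonneg _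
  have hu0 : ‖u 0‖ = ‖v 0‖ := by rw [h0]
  have hvK : ‖v K‖ ≤ ‖v 0‖ := norm_exact_le T hT v hv K
  have hvK2 : ‖v K‖ ^ 2 ≤ ‖v 0‖ ^ 2 := pow_le_pow_left₀ (norm_nonneg _) hvK 2
  have hdropv : 0 ≤ ‖v 0‖ ^ 2 - ‖v K‖ ^ 2 := sub_nonneg.mpr hvK2
  -- the f-sums and slop sums against the budgets
  have hbud := hbudget
  have hfsum : ∀ (m₁ : ℝ), 0 ≤ m₁ →
      ∑ k ∈ Finset.range K, (m₁ * (a k * ‖u 0‖) + 2 * a k ^ 2 + m₁ * (‖u 0‖ * ‖adjoint (T k) (f k)‖)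
        + 2 * |⟪e k, f k⟫_ℝ| + ‖f k‖ ^ 2)
      ≤ m₁ * (‖v 0‖ * ∑ k ∈ Finset.range K, a k) + 2 * ∑ k ∈ Finset.range K, a k ^ 2
        + m₁ * (‖v 0‖ * ∑ k ∈ Finset.range K, s k)
        + (η' * ∑ k ∈ Finset.range K, (‖u k‖ ^ 2 - ‖T k (u k)‖ ^ 2) + B) := by
    intro m₁ hm₁
    have h1 : ∑ k ∈ Finset.range K, (m₁ * (a k * ‖u 0‖) + 2 * a k ^ 2 + m₁ * (‖u 0‖ * ‖adjoint (T k) (f k)‖)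
          + 2 * |⟪e k, f k⟫_ℝ| + ‖f k‖ ^ 2)
        ≤ ∑ k ∈ Finset.range K, (m₁ * ‖v 0‖ * a k + 2 * a k ^ 2 + m₁ * ‖v 0‖ * s k + (F k + 2 * c k)) :=
      Finset.sum_le_sum fun k _ => by
        have a1 : m₁ * (‖u 0‖ * ‖adjoint (T k) (f k)‖) ≤ m₁ * (‖u 0‖ * s k) :=
          mul_le_mul_of_nonneg_left (mul_le_mul_of_nonneg_left (hF3 k) (norm_nonneg _)) hm₁
        rw [hu0] at a1 ⊢
        linarith [hF1 k, hF4 k]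
    have hsplit : ∑ k ∈ Finset.range K, (m₁ * ‖v 0‖ * a k + 2 * a k ^ 2 + m₁ * ‖v 0‖ * s k + (F k + 2 * c k))
        = m₁ * ‖v 0‖ * ∑ k ∈ Finset.range K, a k + 2 * ∑ k ∈ Finset.range K, a k ^ 2
          + m₁ * ‖v 0‖ * ∑ k ∈ Finset.range K, s k + ∑ k ∈ Finset.range K, (F k + 2 * c k) := by
      rw [Finset.sum_add_distrib, Finset.sum_add_distrib, Finset.sum_add_distrib, ← Finset.mul_sum, ← Finset.mul_sum,
        ← Finset.mul_sum]
    rw [hsplit] at h1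
    have e1 : m₁ * ‖v 0‖ * ∑ k ∈ Finset.range K, a k = m₁ * (‖v 0‖ * ∑ k ∈ Finset.range K, a k) := by ring
    have e2 : m₁ * ‖v 0‖ * ∑ k ∈ Finset.range K, s k = m₁ * (‖v 0‖ * ∑ k ∈ Finset.range K, s k) := by ring
    linarith
  -- energy and discrepancy sums
  have hSu := dissip_sum_le_slop T hT u e f η a hη ha hu huB hDD K
  have hd := norm_sq_sub_le_slop T hT u v e f η a hη ha h0 hv hu huB hDD K
  have hf2 := hfsum 2 (by norm_num)
  have hf4 := hfsum 4 (by norm_num)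
  -- duality at `z = v K`
  obtain ⟨b, hb, hdual, hbound⟩ := duality_sum_slop T hT u v e f η a hη ha h0 hv hu hDD K (v K)
  have hvv : ⟪b, v 0⟫_ℝ = ‖v K‖ ^ 2 := by rw [hdual, real_inner_self_eq_norm_sq]
  have hkey : ‖v K‖ ^ 2 - ‖b‖ ^ 2 ≤ ‖v 0‖ ^ 2 - ‖v K‖ ^ 2 := by
    have h1 : ‖v K‖ ^ 2 ≤ ‖b‖ * ‖v 0‖ := by rw [← hvv]; exact real_inner_le_norm _ _
    by_cases h00 : ‖v 0‖ = 0
    · have : ‖v K‖ = 0 := le_antisymm (by rw [← h00]; exact hvK) (norm_nonneg _)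
      rw [this, h00]; nlinarith [norm_nonneg b]
    · have hpos : 0 < ‖v 0‖ ^ 2 := by positivity
      have h3 : (‖v K‖ ^ 2 - ‖b‖ ^ 2) * ‖v 0‖ ^ 2 ≤ (‖v 0‖ ^ 2 - ‖v K‖ ^ 2) * ‖v 0‖ ^ 2 := by
        nlinarith [norm_nonneg (v K), sq_nonneg (‖v 0‖ ^ 2 - ‖v K‖ ^ 2), norm_nonneg b]
      exact le_of_mul_le_mul_right h3 hpos
  -- the f-pairings in the duality sum
  have hfdual : ‖v K‖ * ∑ k ∈ Finset.range (K - 1), ‖T (k + 1) (f k)‖ + (if K = 0 then 0 else |⟪v K, f (K - 1)⟫_ℝ|)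
      ≤ 2 * (‖v 0‖ * ∑ k ∈ Finset.range K, s k) := by
    have hpart : ∑ k ∈ Finset.range (K - 1), ‖T (k + 1) (f k)‖ ≤ ∑ k ∈ Finset.range K, s k := by
      calc ∑ k ∈ Finset.range (K - 1), ‖T (k + 1) (f k)‖ ≤ ∑ k ∈ Finset.range (K - 1), s k :=
            Finset.sum_le_sum fun k _ => hF2 k
        _ ≤ ∑ k ∈ Finset.range K, s k :=
            Finset.sum_le_sum_of_subset_of_nonneg (Finset.range_mono (Nat.sub_le K 1)) fun k _ _ => hs k
    have h1 : ‖v K‖ * ∑ k ∈ Finset.range (K - 1), ‖T (k + 1) (f k)‖ ≤ ‖v 0‖ * ∑ k ∈ Finset.range K, s k :=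
      mul_le_mul hvK hpart (Finset.sum_nonneg fun k _ => norm_nonneg _) hv0
    have h2 : (if K = 0 then 0 else |⟪v K, f (K - 1)⟫_ℝ|) ≤ ‖v 0‖ * ∑ k ∈ Finset.range K, s k := by
      rcases Nat.eq_zero_or_pos K with hK0 | hKpos
      · subst hK0; simp only [if_true]; positivity
      · rw [if_neg (by omega)]
        have hK : K = (K - 1) + 1 := by omega
        have hvK' : v K = T (K - 1) (v (K - 1)) := by
          conv_lhs => rw [hK]
          exact hv (K - 1)
        calc |⟪v K, f (K - 1)⟫_ℝ| = |⟪T (K - 1) (v (K - 1)), f (K - 1)⟫_ℝ| := by rw [hvK']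
          _ ≤ ‖v (K - 1)‖ * ‖adjoint (T (K - 1)) (f (K - 1))‖ := abs_inner_apply_le_norm_mul_adjoint _ _ _
          _ ≤ ‖v 0‖ * s (K - 1) := mul_le_mul (norm_exact_le T hT v hv (K - 1)) (hF3 _) (norm_nonneg _) hv0
          _ ≤ ‖v 0‖ * ∑ k ∈ Finset.range K, s k := by
              refine mul_le_mul_of_nonneg_left ?_ hv0
              exact Finset.single_le_sum (fun k _ => hs k) (Finset.mem_range.mpr (by omega))
    linarith
  have hadual : ‖v K‖ * ∑ k ∈ Finset.range K, a k ≤ ‖v 0‖ * ∑ k ∈ Finset.range K, a k :=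
    mul_le_mul_of_nonneg_right hvK hA
  have hcross : 2 * ⟪v K, u K - v K⟫_ℝ ≤
      η * (∑ k ∈ Finset.range K, (‖u k‖ ^ 2 - ‖T k (u k)‖ ^ 2) + (‖v 0‖ ^ 2 - ‖v K‖ ^ 2))
        + 4 * (‖v 0‖ * ∑ k ∈ Finset.range K, s k) + 2 * (‖v 0‖ * ∑ k ∈ Finset.range K, a k) := by
    have hA' : 0 ≤ η * Real.sqrt (∑ k ∈ Finset.range K, (‖u k‖ ^ 2 - ‖T k (u k)‖ ^ 2)) := mul_nonneg hη (Real.sqrt_nonneg _)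
    have h1 : η * Real.sqrt (∑ k ∈ Finset.range K, (‖u k‖ ^ 2 - ‖T k (u k)‖ ^ 2)) * Real.sqrt (‖v K‖ ^ 2 - ‖b‖ ^ 2)
        ≤ η * Real.sqrt (∑ k ∈ Finset.range K, (‖u k‖ ^ 2 - ‖T k (u k)‖ ^ 2)) * Real.sqrt (‖v 0‖ ^ 2 - ‖v K‖ ^ 2) :=
      mul_le_mul_of_nonneg_left (Real.sqrt_le_sqrt hkey) hA'
    -- AM–GM on the cross term
    have hamgm : 2 * (η * Real.sqrt (∑ k ∈ Finset.range K, (‖u k‖ ^ 2 - ‖T k (u k)‖ ^ 2)) * Real.sqrt (‖v 0‖ ^ 2 - ‖v K‖ ^ 2))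
        ≤ η * (∑ k ∈ Finset.range K, (‖u k‖ ^ 2 - ‖T k (u k)‖ ^ 2) + (‖v 0‖ ^ 2 - ‖v K‖ ^ 2)) := by
      have h := two_mul_le_add_sq (Real.sqrt (∑ k ∈ Finset.range K, (‖u k‖ ^ 2 - ‖T k (u k)‖ ^ 2)))
        (Real.sqrt (‖v 0‖ ^ 2 - ‖v K‖ ^ 2))
      rw [Real.sq_sqrt hS, Real.sq_sqrt hdropv] at h
      have := mul_le_mul_of_nonneg_left h hη
      linarith
    linarith [le_abs_self ⟪v K, u K - v K⟫_ℝ]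
  have hexp : ‖u K‖ ^ 2 = ‖v K‖ ^ 2 + 2 * ⟪v K, u K - v K⟫_ℝ + ‖u K - v K‖ ^ 2 := by
    rw [← norm_add_sq_real, add_sub_cancel]
  refine ledger_arith_slop (S := ∑ k ∈ Finset.range K, (‖u k‖ ^ 2 - ‖T k (u k)‖ ^ 2))
    (P₁ := ‖v 0‖ * ∑ k ∈ Finset.range K, s k) (P₂ := ‖v 0‖ * ∑ k ∈ Finset.range K, a k)
    hη hη8 hη' hη'8 hS (mul_nonneg hv0 hSs) (mul_nonneg hv0 hA) hA₂ hB hvK2 ?_ ?_ |>.trans (le_of_eq (by ring))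
  · -- collect: `‖u K‖² ≤ ‖v K‖² + η·drop_v + (η + 3η² + η′)·S + 8 P₁ + 6 P₂ + 2 A₂ + B`
    linarith [hexp, hcross, hd, hf4]
  · -- energy sum
    have hu0sq : ‖u 0‖ ^ 2 = ‖v 0‖ ^ 2 := by rw [hu0]
    linarith [hSu, hf2, hu0sq]

end

end Summit.AnomalousDissipation.AnomalousDissipation.Theorems.SolenoidalFractalHomogenisation.LagrangianStep
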